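import Literature.RingTheory.FittingIdeal.FittingLemma
import Summits.BirchSwinnertonDyer.Rank1Residual.X1.GeneratorCountSqueeze
import HarnessLib

/-!
# LEMMA M, Fitting half: a generator count `p^B ≤ #(X/𝔪X)` forces `Fitt₀(X) ⊆ 𝔪^B`

B2B cell `bsd-rank1-residual`, unit `eisenstein-p1` GEN 17, FILE 10 (X1R0-GAPMAP §26;
`V76-LOCAL-TERM-PLAN.md` §3). HONEST FRAMING: research route; THEOREMS ONLY (no `def`, no named
fact); nothing booked. This is the first brick of the ord/Fitting form of LEMMA M (X1R0-GAPMAP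
§21.1), the form the seven `M:paper` classes use at layer 1: for a finitely generated module `X`
over a local ring `(R, 𝔪)` that needs at least `B` generators, EVERY relation among a minimal
generating family has all its coefficients in `𝔪`, so every maximal minor of a relation matrix lies
in `𝔪^B`, i.e. `Fitt₀(X) ⊆ 𝔪^B` (§1, any local ring). Over `Λ = ℤ_p⟦T⟧` the count is read from
`p^B ≤ #(X/𝔪X)` (§2: `#(X/𝔪X) ≤ p^n` for `n` generators, by the surjection
`(ℤ/p)^n → X/𝔪X`), which is route M's typed input `GeneratorCountGE` (§3). The remaining half of
LEMMA M — `char(X) ⊆ Fitt₀(X)` for `X` without non-zero finite submodules (square presentation,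
`pd ≤ 1`) — is NOT proved here.

## Sources
* D. Eisenbud, *Commutative Algebra*, GTM 150, §20.2 (Fitting ideals; Fitting's lemma — tree
  `Literature/RingTheory/FittingIdeal/FittingLemma.lean`).
* The Stacks Project, Tag 07ZC (Fitting ideals over a local ring).
* R. Greenberg, LNM 1716 (1999), p. 137 (the generator count `dim X/𝔪X`).
-/

namespace Summit.BirchSwinnertonDyer.Rank1Residual.X1.GeneratorBoundFitting

open Literature.RingTheory.FittingIdeal IsLocalRing PowerSeries
  Literature.NumberTheory.EllipticCurves Literature.NumberTheory.GaloisRepresentations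
  Literature.NumberTheory.EllipticCurves.IwasawaAlgebra
  Literature.NumberTheory.EllipticCurves.Rank1Residual
  Literature.NumberTheory.EllipticCurves.Greenberg1999

/-! ## §1. Over a local ring: minimal relations have coefficients in `𝔪` -/

section LocalRing

variable {R : Type*} [CommRing R] {M : Type*} [AddCommGroup M] [Module R M]

/-- The determinant of a square matrix with all entries in an ideal `I` lies in `I ^ n`
(Leibniz expansion). [folklore] -/
theorem det_mem_pow_of_forall_mem {n : ℕ} {I : Ideal R} (A : Matrix (Fin n) (Fin n) R)
    (h : ∀ i j, A i j ∈ I) : A.det ∈ I ^ n := by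
  rw [Matrix.det_apply']
  refine Ideal.sum_mem _ fun σ _ => Ideal.mul_mem_left _ _ ?_
  have hprod : (∏ i : Fin n, A (σ i) i) ∈ ∏ _i : Fin n, I :=
    Ideal.prod_mem_prod fun i _ => h (σ i) i
  simpa [Finset.prod_const, Finset.card_univ, Fintype.card_fin] using hprod

/-- Over a local ring `(R, 𝔪)`: if `M` cannot be generated by fewer than `g` elements, then every
relation `∑ ρₗ xₗ = 0` among a generating family `x₁, …, x_g` of size exactly `g` has all its
coefficients in `𝔪` — a unit coefficient would make `x_l` redundant. [cite: StacksProject, Tag 07ZC] -/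
theorem relation_mem_maximalIdeal_of_minimal [IsLocalRing R] {g : ℕ} (x : Fin g → M)
    (hx : Submodule.span R (Set.range x) = ⊤)
    (hmin : ∀ (n : ℕ) (y : Fin n → M), Submodule.span R (Set.range y) = ⊤ → g ≤ n)
    (ρ : Fin g → R) (hρ : ∑ l, ρ l • x l = 0) (l : Fin g) : ρ l ∈ maximalIdeal R := by
  by_contra hl
  have hu : IsUnit (ρ l) := by
    simpa [mem_maximalIdeal, mem_nonunits_iff] using hl
  -- `g = g' + 1`
  obtain ⟨g', rfl⟩ : ∃ g', g = g' + 1 := ⟨g - 1, (Nat.succ_pred_eq_of_pos (Fin.pos l)).symm⟩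
  -- the family without `x_l`
  set y : Fin g' → M := fun i => x (l.succAbove i) with hy
  set S : Submodule R M := Submodule.span R (Set.range y) with hS
  have hsum : ρ l • x l + ∑ i : Fin g', ρ (l.succAbove i) • x (l.succAbove i) = 0 := by
    rw [← hρ, Fin.sum_univ_succAbove _ l]
  have hmem : ρ l • x l ∈ S := by
    have : ρ l • x l = -(∑ i : Fin g', ρ (l.succAbove i) • x (l.succAbove i)) :=
      eq_neg_of_add_eq_zero_left hsum
    rw [this]
    exact S.neg_mem (S.sum_mem fun i _ => S.smul_mem _ (Submodule.subset_span ⟨i, rfl⟩))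
  have hxl : x l ∈ S := by
    obtain ⟨u, hu'⟩ := hu
    rw [← hu'] at hmem
    exact (Submodule.smul_mem_iff' S u).1 hmem
  have htop : S = ⊤ := by
    refine le_antisymm le_top ?_
    rw [← hx, Submodule.span_le]
    rintro _ ⟨i, rfl⟩
    by_cases hi : i = l
    · subst hi; exact hxl
    · obtain ⟨j, rfl⟩ := Fin.exists_succAbove_eq hi
      exact Submodule.subset_span ⟨j, rfl⟩
  have := hmin g' y htop
  omega

/-- **`Fitt₀(M) ⊆ 𝔪^g` if `M` needs at least `g` generators** (local ring `(R, 𝔪)`, `M` finite):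
choose a generating family of minimal size `n ≥ g`; by Fitting's lemma `Fitt₀(M)` is the ideal of
`n × n` minors of relation matrices for it, all of whose entries lie in `𝔪`
(`relation_mem_maximalIdeal_of_minimal`), so each minor lies in `𝔪^n ⊆ 𝔪^g`.
[cite: StacksProject, Tag 07ZC] -/
theorem fittingIdeal_zero_le_maximalIdeal_pow [IsLocalRing R] [Module.Finite R M] {g : ℕ}
    (hmin : ∀ (n : ℕ) (y : Fin n → M), Submodule.span R (Set.range y) = ⊤ → g ≤ n) :
    Module.fittingIdeal R M 0 ≤ maximalIdeal R ^ g := by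
  classical
  have hex : ∃ n, ∃ y : Fin n → M, Submodule.span R (Set.range y) = ⊤ :=
    Module.Finite.exists_fin
  let n := Nat.find hex
  obtain ⟨x, hx⟩ : ∃ y : Fin n → M, Submodule.span R (Set.range y) = ⊤ := Nat.find_spec hex
  have hnmin : ∀ (m : ℕ) (y : Fin m → M), Submodule.span R (Set.range y) = ⊤ → n ≤ m :=
    fun m y hy => Nat.find_min' hex ⟨y, hy⟩
  have hgn : g ≤ n := hmin n x hx
  refine le_trans ?_ (Ideal.pow_le_pow_right hgn)
  rw [Module.fittingIdeal_eq_relMinorIdeal x hx 0, Nat.sub_zero, Module.relMinorIdeal_le_iff]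
  intro ρ σ hρ
  exact det_mem_pow_of_forall_mem _ fun i i' =>
    relation_mem_maximalIdeal_of_minimal x hx hnmin (ρ i) (hρ i) (σ i')

end LocalRing

/-! ## §2. Over `Λ = ℤ_p⟦T⟧`: `n` generators ⇒ `#(X/𝔪X) ≤ p^n` -/

section Iwasawa

variable {p : ℕ} [Fact p.Prime] {M : Type*} [AddCommGroup M] [Module (IwasawaAlgebra p) M]

/-- The surjection `Λ → ℤ/p`, `r ↦ r(0) mod p`, whose kernel is the maximal ideal `𝔪 = (p, T)`.
[folklore] -/
theorem ker_toZMod_comp_constantCoeff :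
    RingHom.ker ((PadicInt.toZMod (p := p)).comp (PowerSeries.constantCoeff (R := ℤ_[p]))) =
      maximalIdeal (IwasawaAlgebra p) :=
  eq_maximalIdeal (RingHom.ker_isMaximal_of_surjective _ (ZMod.ringHom_surjective _))

/-- In `X/𝔪X`, a scalar `r ∈ Λ` acts as the integer `(r(0) mod p).val`. [folklore] -/
theorem smul_mkQ_eq_val_smul (r : IwasawaAlgebra p) (x : M) :
    r • (Submodule.mkQ (maximalIdeal (IwasawaAlgebra p) • (⊤ : Submodule (IwasawaAlgebra p) M)) x)
      = ((((PadicInt.toZMod (p := p)).comp (PowerSeries.constantCoeff (R := ℤ_[p]))) r).val :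
          IwasawaAlgebra p) •
        (Submodule.mkQ (maximalIdeal (IwasawaAlgebra p) • (⊤ : Submodule (IwasawaAlgebra p) M)) x)
      := by
  set f := (PadicInt.toZMod (p := p)).comp (PowerSeries.constantCoeff (R := ℤ_[p])) with hf
  rw [← sub_eq_zero, ← sub_smul, ← map_smul, Submodule.mkQ_apply, Submodule.Quotient.mk_eq_zero]
  refine Submodule.smul_mem_smul ?_ Submodule.mem_top
  rw [← ker_toZMod_comp_constantCoeff, RingHom.mem_ker, map_sub, map_natCast, ZMod.natCast_val,
    ZMod.cast_id', id, sub_self]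

/-- **`#(X/𝔪X) ≤ p^n` if `X` is generated by `n` elements** over `Λ = ℤ_p⟦T⟧`: the function
`(ℤ/p)^n → X/𝔪X`, `c ↦ ∑ cᵢ x̄ᵢ`, is onto. [folklore] -/
theorem natCard_quotient_maximalIdeal_smul_top_le_pow {n : ℕ} (y : Fin n → M)
    (hy : Submodule.span (IwasawaAlgebra p) (Set.range y) = ⊤) :
    Nat.card (M ⧸ maximalIdeal (IwasawaAlgebra p) • (⊤ : Submodule (IwasawaAlgebra p) M))
      ≤ p ^ n := by
  classical
  set N := maximalIdeal (IwasawaAlgebra p) • (⊤ : Submodule (IwasawaAlgebra p) M) with hN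
  set f := (PadicInt.toZMod (p := p)).comp (PowerSeries.constantCoeff (R := ℤ_[p])) with hf
  let φ : (Fin n → ZMod p) → M ⧸ N := fun c => ∑ i, ((c i).val : IwasawaAlgebra p) • N.mkQ (y i)
  have hφ : Function.Surjective φ := by
    intro z
    obtain ⟨m, rfl⟩ := N.mkQ_surjective z
    have hm : m ∈ Submodule.span (IwasawaAlgebra p) (Set.range y) := by rw [hy]; trivial
    obtain ⟨c, hc⟩ := (Submodule.mem_span_range_iff_exists_fun (IwasawaAlgebra p)).1 hm
    refine ⟨fun i => f (c i), ?_⟩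
    simp only [φ]
    rw [← hc, map_sum]
    refine Finset.sum_congr rfl fun i _ => ?_
    rw [map_smul, smul_mkQ_eq_val_smul (c i) (y i)]
  calc Nat.card (M ⧸ N) ≤ Nat.card (Fin n → ZMod p) := Nat.card_le_card_of_surjective φ hφ
    _ = p ^ n := by simp [Nat.card_eq_fintype_card, ZMod.card]

/-- **A count `p^B ≤ #(X/𝔪X)` means `X` needs at least `B` generators.** [folklore] -/
theorem le_of_pow_le_natCard_quotient {B : ℕ}
    (hB : p ^ B ≤ Nat.card (M ⧸ maximalIdeal (IwasawaAlgebra p) •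
      (⊤ : Submodule (IwasawaAlgebra p) M)))
    (n : ℕ) (y : Fin n → M) (hy : Submodule.span (IwasawaAlgebra p) (Set.range y) = ⊤) :
    B ≤ n :=
  (Nat.pow_le_pow_iff_right (Nat.Prime.one_lt (Fact.out : p.Prime))).1
    (hB.trans (natCard_quotient_maximalIdeal_smul_top_le_pow y hy))

/-- **LEMMA M, Fitting half, over `Λ`:** for a finitely generated `Λ`-module `X` with
`p^B ≤ #(X/𝔪X)`, `Fitt₀(X) ⊆ 𝔪^B`. [cite: StacksProject, Tag 07ZC] -/
theorem fittingIdeal_zero_le_maximalIdeal_pow_of_pow_le_natCard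
    [Module.Finite (IwasawaAlgebra p) M] {B : ℕ}
    (hB : p ^ B ≤ Nat.card (M ⧸ maximalIdeal (IwasawaAlgebra p) •
      (⊤ : Submodule (IwasawaAlgebra p) M))) :
    Module.fittingIdeal (IwasawaAlgebra p) M 0 ≤ maximalIdeal (IwasawaAlgebra p) ^ B :=
  fittingIdeal_zero_le_maximalIdeal_pow (le_of_pow_le_natCard_quotient hB)

end Iwasawa

/-! ## §3. Route M's typed count `GeneratorCountGE` ⇒ `Fitt₀(X(E/ℚ_∞)) ⊆ 𝔪^B` -/

section Selmer

open WeierstrassCurve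

/-- **Route M's count in Fitting form:** under the typed count `GeneratorCountGE W p B`
(`p^B ≤ #(X/𝔪X)` for every torsion Pontryagin-dual Selmer datum over the cyclotomic tower), the
zeroth Fitting ideal of `X = X(E/ℚ_∞)` lies in `𝔪^B`. With the (unproved here) equality
`Fitt₀(X) = char(X)` for `X` without non-zero finite submodules this is LEMMA M:
`char(X) ⊆ 𝔪^B`, i.e. `ord_𝔪 f_E ≥ B`. [cite: GreenbergLNM1716, p. 137 (the count; shape only)] -/
theorem fittingIdeal_zero_le_of_generatorCountGE {W : WeierstrassCurve ℚ} [W.IsElliptic]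
    [W.IsGloballyMinimal] {p : ℕ} [Fact p.Prime] {B : ℕ}
    (hcount : GeneratorCountSqueeze.GeneratorCountGE W p B)
    (κ : ZpExtension ℚ p) (γ : Field.absoluteGaloisGroup ℚ) (hκ : κ.IsCyclotomic)
    (hγ : κ.IsTopGenerator γ) (hγv : IsCyclotomicVariable p γ) (D : W.SelmerDualData κ γ)
    [Module.Finite (IwasawaAlgebra p) D.X] (hD : D.IsTorsion) :
    Module.fittingIdeal (IwasawaAlgebra p) D.X 0 ≤ maximalIdeal (IwasawaAlgebra p) ^ B :=
  fittingIdeal_zero_le_maximalIdeal_pow_of_pow_le_natCard (hcount κ γ hκ hγ hγv D hD)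

end Selmer

/-! ## §4. `f ∈ 𝔪^B` coefficientwise: `p^{B-i} ∣ f_i` (the "ord" reading of LEMMA M) -/

section Coeff

variable {p : ℕ} [Fact p.Prime]

/-- `h ∈ 𝔪 ⇒ p ∣ h(0)` in `Λ = ℤ_p⟦T⟧`. [folklore] -/
theorem p_dvd_constantCoeff_of_mem_maximalIdeal {h : IwasawaAlgebra p}
    (hh : h ∈ maximalIdeal (IwasawaAlgebra p)) : (p : ℤ_[p]) ∣ constantCoeff h := by
  rw [← ker_toZMod_comp_constantCoeff, RingHom.mem_ker, RingHom.comp_apply] at hh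
  have h1 : constantCoeff h ∈ RingHom.ker (PadicInt.toZMod (p := p)) := hh
  rwa [PadicInt.ker_toZMod, PadicInt.maximalIdeal_eq_span_p, Ideal.mem_span_singleton] at h1

/-- **`f ∈ 𝔪^B ⇒ p^{B−i} ∣ f_i` for every `i`** (`𝔪 = (p, T)`; truncated subtraction, so the
statement is empty for `i ≥ B`): `ord_𝔪 f := min_i (v_p(f_i) + i) ≥ B`. Induction on `B` over
`𝔪^{B+1} = 𝔪^B · 𝔪` and the Cauchy product. [folklore] -/
theorem pow_dvd_coeff_of_mem_maximalIdeal_pow {B : ℕ} {f : IwasawaAlgebra p}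
    (hf : f ∈ maximalIdeal (IwasawaAlgebra p) ^ B) : ∀ i : ℕ, (p : ℤ_[p]) ^ (B - i) ∣ coeff i f := by
  induction B generalizing f with
  | zero => intro i; simp
  | succ B ih =>
    rw [pow_succ] at hf
    refine Submodule.mul_induction_on hf (fun g hg h hh i => ?_) (fun g h hg hh i => ?_)
    · rw [coeff_mul]
      refine Finset.dvd_sum fun jk hjk => ?_
      have hj := ih hg jk.1
      have hk : (p : ℤ_[p]) ^ (1 - jk.2) ∣ coeff jk.2 h := by
        rcases Nat.eq_zero_or_pos jk.2 with h0 | hpos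
        · rw [h0, Nat.sub_zero, pow_one, coeff_zero_eq_constantCoeff_apply]
          exact p_dvd_constantCoeff_of_mem_maximalIdeal hh
        · rw [Nat.sub_eq_zero_of_le hpos, pow_zero]; exact one_dvd _
      have hsum : B + 1 - i ≤ (B - jk.1) + (1 - jk.2) := by
        have := Finset.HasAntidiagonal.mem_antidiagonal.1 hjk; omega
      exact (pow_dvd_pow _ hsum).trans (by rw [pow_add]; exact mul_dvd_mul hj hk)
    · rw [map_add]; exact dvd_add (hg i) (hh i)

variable {M : Type*} [AddCommGroup M] [Module (IwasawaAlgebra p) M]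

/-- **LEMMA M modulo `f ∈ Fitt₀(X)`:** if `p^B ≤ #(X/𝔪X)` and `f` lies in the zeroth Fitting ideal
of the finitely generated `Λ`-module `X` (e.g. `f = det` of a square presentation, in particular a
characteristic power series of `X` when `X` has no non-zero finite submodule — NOT proved here),
then `p^{B−i} ∣ f_i` for all `i`, i.e. `ord_𝔪 f ≥ B`. [cite: GreenbergLNM1716, p. 137 (the count; shape only)] -/
theorem pow_dvd_coeff_of_mem_fittingIdeal_of_pow_le_natCard [Module.Finite (IwasawaAlgebra p) M]
    {B : ℕ} (hB : p ^ B ≤ Nat.card (M ⧸ maximalIdeal (IwasawaAlgebra p) •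
      (⊤ : Submodule (IwasawaAlgebra p) M)))
    {f : IwasawaAlgebra p} (hfit : f ∈ Module.fittingIdeal (IwasawaAlgebra p) M 0) (i : ℕ) :
    (p : ℤ_[p]) ^ (B - i) ∣ coeff i f :=
  pow_dvd_coeff_of_mem_maximalIdeal_pow
    (fittingIdeal_zero_le_maximalIdeal_pow_of_pow_le_natCard hB hfit) i

end Coeff

/-! ## §5. The census reading: `B ≤ v_p(f_i) + i` (appended, GEN 17) -/

section CoeffValuation

variable {p : ℕ} [Fact p.Prime]

/-- **`f ∈ 𝔪^B ⇒ B ≤ v_p(f_i) + i` for every non-zero coefficient `f_i`** — the census's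
`mord(f) := min_i (v_p(f_i) + i) ≥ B` (X1R0-GAPMAP §21.1) read off
`pow_dvd_coeff_of_mem_maximalIdeal_pow`. [folklore] -/
theorem le_valuation_coeff_add_of_mem_maximalIdeal_pow {B : ℕ} {f : IwasawaAlgebra p}
    (hf : f ∈ maximalIdeal (IwasawaAlgebra p) ^ B) (i : ℕ) (hi : coeff i f ≠ 0) :
    B ≤ (coeff i f).valuation + i := by
  have h := pow_dvd_coeff_of_mem_maximalIdeal_pow hf i
  rw [← Ideal.mem_span_singleton, PadicInt.mem_span_pow_iff_le_valuation _ hi] at h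
  omega

variable {M : Type*} [AddCommGroup M] [Module (IwasawaAlgebra p) M]

/-- **`p^B ≤ #(X/𝔪X)` and `f ∈ Fitt₀(X)` ⇒ `B ≤ v_p(f_i) + i`** for every non-zero coefficient.
[cite: GreenbergLNM1716, p. 137 (the count; shape only)] -/
theorem le_valuation_coeff_add_of_mem_fittingIdeal_of_pow_le_natCard
    [Module.Finite (IwasawaAlgebra p) M] {B : ℕ}
    (hB : p ^ B ≤ Nat.card (M ⧸ maximalIdeal (IwasawaAlgebra p) •
      (⊤ : Submodule (IwasawaAlgebra p) M)))
    {f : IwasawaAlgebra p} (hfit : f ∈ Module.fittingIdeal (IwasawaAlgebra p) M 0) (i : ℕ)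
    (hi : coeff i f ≠ 0) : B ≤ (coeff i f).valuation + i :=
  le_valuation_coeff_add_of_mem_maximalIdeal_pow
    (fittingIdeal_zero_le_maximalIdeal_pow_of_pow_le_natCard hB hfit) i hi

end CoeffValuation

end Summit.BirchSwinnertonDyer.Rank1Residual.X1.GeneratorBoundFitting
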